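import Summits.Ventures.PercRepro.C041SeedCoverHalf
import Summits.Ventures.PercRepro.C041SeedCoverBox16a
import Summits.Ventures.PercRepro.C041SeedCoverBox16b
import Summits.Ventures.PercRepro.C041SeedCoverBox16c

/-!
# THE LAST SEED ON THE HALF-SQUARE `A, B ≤ 1/2`, `6/5 ≤ P₁ ≤ 9/2` — WITHOUT THE CORNER CONDITION (mine-3, gen 64;
C-041.md §21 (ay) addendum 5)

With the corner boxes `C041SeedCoverBox16a/b/c` (`A ∈ [3/10, 1/2]`, `B ∈ [0, 1/20]`, `P₁ ∈ [79/20, 169/40]`, `[169/40, 349/80]`,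
`[349/80, 9/2]`; 2-D tilings by the slab theorems 140–178 of the corner) the half-square theorem of `C041SeedCoverHalf` loses its corner hypothesis:
every star with `m ≥ 2` leaves, `A ≤ 1/2`, `B ≤ 1/2` and `6/5 ≤ P₁ ≤ 9/2` has `θ_△(v 1, V a) ∈ cone`
(`InCone_thetaTri_v1_V_half_full`); and the lower bound `P₁ ≥ 6/5` is needed only for `A ≤ 1/20` (`InCone_thetaTri_v1_V_half_all`):
for `A ≥ 1/20`, `B ≤ 1/20` the range `P₁ < 6/5` is empty (`half_low_empty`), for `A, B ≥ 1/20` the bulk theorem has no `P₁` condition.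
-/

namespace PercRepro

namespace RelaxedTriangle

open TreeClosure

/-- **THE SEED ON THE HALF-SQUARE.** Every star with `m ≥ 2` leaves, `A ≤ 1/2`, `B ≤ 1/2` and `6/5 ≤ P₁ ≤ 9/2` has
`θ_△(v 1, V a) ∈ cone`. -/
theorem InCone_thetaTri_v1_V_half_full {m : ℕ} (a : Fin (m + 2) → ℝ) (ha : ∀ i, 0 ≤ a i ∧ a i ≤ 1)
    (hA : ∏ i, a i ≤ 1 / 2) (hB : ∏ i, (1 - a i) ≤ 1 / 2)
    (hP : (6 / 5 : ℝ) ≤ ∏ i, (1 + a i ^ 2) ∧ ∏ i, (1 + a i ^ 2) ≤ 9 / 2) :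
    InCone (thetaTri (v 1) (V a)) := by
  rcases le_or_gt (∏ i, (1 + a i ^ 2)) (79 / 20) with hlow | hlow
  · exact InCone_thetaTri_v1_V_half a ha hA hB hP (fun _ _ => hlow)
  rcases le_or_gt (∏ i, a i) (3 / 10) with hA3 | hA3
  · exact InCone_thetaTri_v1_V_half a ha hA hB hP (fun h _ => absurd hA3 (not_le.mpr h))
  rcases le_or_gt (∏ i, (1 - a i)) (1 / 20) with hB1 | hB1
  · obtain ⟨hB00, _⟩ := prod_unit_mem (fun i => 1 - a i) (fun i => ⟨by linarith [(ha i).2], by linarith [(ha i).1]⟩)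
    rcases le_or_gt (∏ i, (1 + a i ^ 2)) (169 / 40) with h1 | h1
    · exact InCone_thetaTri_v1_V_box16a a ha ⟨hA3.le, hA⟩ ⟨hB00, hB1⟩ ⟨hlow.le, h1⟩
    rcases le_or_gt (∏ i, (1 + a i ^ 2)) (349 / 80) with h2 | h2
    · exact InCone_thetaTri_v1_V_box16b a ha ⟨hA3.le, hA⟩ ⟨hB00, hB1⟩ ⟨h1.le, h2⟩
    · exact InCone_thetaTri_v1_V_box16c a ha ⟨hA3.le, hA⟩ ⟨hB00, hB1⟩ ⟨h2.le, hP.2⟩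
  · exact InCone_thetaTri_v1_V_half a ha hA hB hP (fun _ h => absurd hB1 (not_lt.mpr h))

/-- For `A ≥ 1/20`, `B ≤ 1/20` no star has `P₁ ≤ 6/5`: the mirror hyperbola `(3/2)(1 − B)² ≤ P₂(P₁ − 1)` forces
`P₂ ≥ 1083/160`, and then `P₂² A ≤ 1` gives `A < 1/20`. -/
theorem half_low_empty (P1 P2 A B : ℝ) (hA0 : 1 / 20 ≤ A) (hB1 : B ≤ 1 / 20) (hP2 : 0 ≤ P2)
    (hRm : 3 / 2 * (1 - B) ^ 2 ≤ P2 * (P1 - 1)) (hu2 : P2 ^ 2 * A ≤ 1) : 6 / 5 < P1 := by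
  by_contra hlow
  have hlow : P1 ≤ 6 / 5 := not_lt.mp hlow
  have hBq : (19 / 20 : ℝ) ^ 2 ≤ (1 - B) ^ 2 := by nlinarith
  have h1 : (3 / 2 : ℝ) * (19 / 20) ^ 2 ≤ P2 * (1 / 5) := by nlinarith [mul_nonneg hP2 (sub_nonneg.2 hlow)]
  have h2 : (1083 / 160 : ℝ) ≤ P2 := by linarith
  have h3 : (1083 / 160 : ℝ) ^ 2 ≤ P2 ^ 2 := by nlinarith [mul_nonneg (sub_nonneg.2 h2) hP2]
  have h4 : (1083 / 160 : ℝ) ^ 2 * (1 / 20) ≤ P2 ^ 2 * A := mul_le_mul h3 hA0 (by norm_num) (sq_nonneg P2)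
  norm_num at h4
  linarith

/-- **THE SEED ON THE HALF-SQUARE BELOW `P₁ = 9/2`.** Every star with `m ≥ 2` leaves, `A ≤ 1/2`, `B ≤ 1/2` and `P₁ ≤ 9/2` has
`θ_△(v 1, V a) ∈ cone`, provided `P₁ ≥ 6/5` when `A ≤ 1/20` (for `A > 1/20` no condition on `P₁` below `9/2`: with `B ≤ 1/20`
the range `P₁ < 6/5` is empty, `half_low_empty`; with `B > 1/20` the bulk theorem applies). -/
theorem InCone_thetaTri_v1_V_half_all {m : ℕ} (a : Fin (m + 2) → ℝ) (ha : ∀ i, 0 ≤ a i ∧ a i ≤ 1)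
    (hA : ∏ i, a i ≤ 1 / 2) (hB : ∏ i, (1 - a i) ≤ 1 / 2) (hP : ∏ i, (1 + a i ^ 2) ≤ 9 / 2)
    (hlow : ∏ i, a i ≤ 1 / 20 → (6 / 5 : ℝ) ≤ ∏ i, (1 + a i ^ 2)) :
    InCone (thetaTri (v 1) (V a)) := by
  rcases le_or_gt (∏ i, a i) (1 / 20) with hA1 | hA1
  · exact InCone_thetaTri_v1_V_half_full a ha hA hB ⟨hlow hA1, hP⟩
  rcases le_or_gt (∏ i, (1 - a i)) (1 / 20) with hB1 | hB1
  · have h2 := one_add_prod_one_sub_sq_le a ha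
    have hRm := sharp_R_mirror a ha
    have hu2 := prod_one_add_one_sub_sq_sq_mul_prod_le_one a ha
    have hP2nn : (0 : ℝ) ≤ ∏ i, (1 + (1 - a i) ^ 2) := bulk_P2_nonneg _ _ h2
    have h65 := half_low_empty _ _ _ _ hA1.le hB1 hP2nn hRm hu2
    exact InCone_thetaTri_v1_V_half_full a ha hA hB ⟨h65.le, hP⟩
  · exact InCone_thetaTri_v1_V_bulk a ha ⟨hA1.le, hA⟩ ⟨hB1.le, hB⟩

end RelaxedTriangle

end PercRepro
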